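import Mathlib.Analysis.InnerProductSpace.Adjoint
import Mathlib.Analysis.InnerProductSpace.GramMatrix
import Mathlib.Analysis.Matrix.PosDef
import Mathlib.Analysis.Complex.Order
import Mathlib.RingTheory.Norm.Transitivity
import Mathlib.RingTheory.Complex
import Mathlib.Analysis.InnerProductSpace.PiL2
import HarnessLib

/-!
# The real Jacobian of a complex-linear map: `J_{2p}(L) = det_ℂ (L* L)` (Wirtinger's equality)

Let `E` and `V` be finite-dimensional complex inner product spaces, `dim_ℂ E = p`, and
`L : E → V` complex-linear. View `E`, `V` as REAL inner product spaces
(`InnerProductSpace.complexToReal`, `⟪x, y⟫_ℝ = Re ⟪x, y⟫_ℂ`). The `2p`-dimensional Jacobian of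
`L`, `J_{2p}(L) = √(det (⟪L bᵢ, L bⱼ⟫_ℝ)ᵢⱼ)` for a real orthonormal basis `b = (b₁, …, b_{2p})` of
`E` — the factor by which `L` multiplies `2p`-dimensional Hausdorff measure
(`Literature/Geometry/GeometricMeasureTheory/AreaFormula.lean`) — equals the determinant of the
COMPLEX Gram matrix `(⟪L eₖ, L eₗ⟫_ℂ)ₖₗ` of any complex orthonormal basis `e = (e₁, …, e_p)`:

* `det_gram_real_eq_normSq_det_gram_complex` — `det (⟪L bᵢ, L bⱼ⟫_ℝ) = |det (⟪L eₖ, L eₗ⟫_ℂ)|²`;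
* `im_det_gram_complex_eq_zero`, `re_det_gram_complex_nonneg` — the complex Gram determinant is
  real and `≥ 0`;
* `sqrt_det_gram_real_eq_re_det_gram_complex` — **`J_{2p}(L) = det (⟪L eₖ, L eₗ⟫_ℂ)`**;
* `sqrt_det_gram_real_eq_one_of_inner_map_map` — `J_{2p}(L) = 1` if `L` is isometric.

This is the linear algebra behind Wirtinger's theorem "the volume of a complex submanifold is
`∫ ωᵖ/p!`" [Chirka1989, §14.1 Lemma 1 and Thm.]: in coordinates, with `M` the matrix of `L`,
`det (MᴴM) = Σ_{#I = p} |det M_I|²` (Cauchy–Binet), the sum of the squared moduli of the complex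
`p × p` minors, and the volume element of the realification of a complex matrix is the squared
modulus of its determinant [Chirka1989, §14.1, proof of Lemma 1; Federer1969, 1.8.2, 3.2.5].
Proof: with `G = L* L` (a complex-linear endomorphism of `E`), both Gram matrices are matrices of
`G` — in the complex basis `e`, respectively of `G` viewed as a real-linear map in the real basis
`b` — so the real Gram determinant is `det_ℝ G = N_{ℂ/ℝ}(det_ℂ G) = |det_ℂ G|²` (Mathlib's
`LinearMap.det_restrictScalars`, `Algebra.norm_complex_apply`), while `det_ℂ G ≥ 0` because complex
Gram matrices are positive semidefinite (`Matrix.posSemidef_gram`).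

Theorems only; the real inner product space structures are `InnerProductSpace.complexToReal`,
introduced by `letI` inside the statements (as in `Literature/Geometry/Kaehler/HolomorphicChainFacts.lean`).

## References

* E. M. Chirka, *Complex Analytic Sets*, Kluwer 1989, §14.1 [Chirka1989].
* H. Federer, *Geometric Measure Theory*, Springer 1969, 1.8.2, 3.2.5 [Federer1969].
-/

open scoped ComplexOrder InnerProductSpace
open Module Matrix

noncomputable section

namespace Literature.Geometry.Kaehler

section ComplexGram

variable {E V : Type*} [NormedAddCommGroup E] [InnerProductSpace ℂ E] [FiniteDimensional ℂ E]
  [NormedAddCommGroup V] [InnerProductSpace ℂ V] [FiniteDimensional ℂ V]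
  {κ : Type*} [Fintype κ] [DecidableEq κ] {ι : Type*} [Fintype ι] [DecidableEq ι]

/-- The Gram operator `G = L* L` represents the Gram form: `⟪x, G y⟫_ℂ = ⟪L x, L y⟫_ℂ`.
[folklore] -/
theorem inner_adjoint_comp_apply (L : E →ₗ[ℂ] V) (x y : E) :
    ⟪x, (LinearMap.adjoint L ∘ₗ L) y⟫_ℂ = ⟪L x, L y⟫_ℂ := by
  rw [LinearMap.comp_apply, LinearMap.adjoint_inner_right]

/-- The complex Gram matrix of `L ∘ e`, `e` a complex orthonormal basis, is the matrix of
`G = L* L` in the basis `e`. [folklore] -/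
theorem gram_complex_eq_toMatrix (L : E →ₗ[ℂ] V) (e : OrthonormalBasis κ ℂ E) :
    Matrix.gram ℂ (L ∘ e) = LinearMap.toMatrix e.toBasis e.toBasis (LinearMap.adjoint L ∘ₗ L) := by
  ext k l
  rw [Matrix.gram_apply, LinearMap.toMatrix_apply, OrthonormalBasis.coe_toBasis_repr_apply,
    OrthonormalBasis.repr_apply_apply, OrthonormalBasis.coe_toBasis, inner_adjoint_comp_apply]
  rfl

/-- `det (⟪L eₖ, L eₗ⟫_ℂ) = det_ℂ (L* L)`. [folklore] -/
theorem det_gram_complex_eq_det (L : E →ₗ[ℂ] V) (e : OrthonormalBasis κ ℂ E) :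
    (Matrix.gram ℂ (L ∘ e)).det = LinearMap.det (LinearMap.adjoint L ∘ₗ L) := by
  rw [gram_complex_eq_toMatrix, LinearMap.det_toMatrix]

omit [FiniteDimensional ℂ V] in
/-- The real inner product of the realification is the real part of the complex one (on `V`).
[folklore] -/
theorem real_inner_eq_re_inner' (x y : V) :
    letI : InnerProductSpace ℝ V := InnerProductSpace.complexToReal
    ⟪x, y⟫_ℝ = (⟪x, y⟫_ℂ).re := rfl

/-- The real Gram matrix of `L ∘ b`, `b` a REAL orthonormal basis of `E`, is the matrix of
`G = L* L` viewed as a real-linear map, in the basis `b`. [folklore] -/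
theorem gram_real_eq_toMatrix (L : E →ₗ[ℂ] V) :
    letI : InnerProductSpace ℝ E := InnerProductSpace.complexToReal
    letI : InnerProductSpace ℝ V := InnerProductSpace.complexToReal
    ∀ b : OrthonormalBasis ι ℝ E, Matrix.gram ℝ (L ∘ b) =
      LinearMap.toMatrix b.toBasis b.toBasis ((LinearMap.adjoint L ∘ₗ L).restrictScalars ℝ) := by
  letI : InnerProductSpace ℝ E := InnerProductSpace.complexToReal
  letI : InnerProductSpace ℝ V := InnerProductSpace.complexToReal
  intro b
  ext i j
  rw [Matrix.gram_apply, LinearMap.toMatrix_apply, OrthonormalBasis.coe_toBasis_repr_apply,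
    OrthonormalBasis.repr_apply_apply, OrthonormalBasis.coe_toBasis, LinearMap.restrictScalars_apply,
    Function.comp_apply, Function.comp_apply, real_inner_eq_re_inner', real_inner_eq_re_inner',
    inner_adjoint_comp_apply]

/-- `det (⟪L bᵢ, L bⱼ⟫_ℝ) = det_ℝ (L* L)` (determinant of the realification). [folklore] -/
theorem det_gram_real_eq_det_restrictScalars (L : E →ₗ[ℂ] V) :
    letI : InnerProductSpace ℝ E := InnerProductSpace.complexToReal
    letI : InnerProductSpace ℝ V := InnerProductSpace.complexToReal
    ∀ b : OrthonormalBasis ι ℝ E,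
      (Matrix.gram ℝ (L ∘ b)).det = LinearMap.det ((LinearMap.adjoint L ∘ₗ L).restrictScalars ℝ) := by
  letI : InnerProductSpace ℝ E := InnerProductSpace.complexToReal
  letI : InnerProductSpace ℝ V := InnerProductSpace.complexToReal
  intro b
  rw [gram_real_eq_toMatrix L b, LinearMap.det_toMatrix]

/-- **Real Gram determinant = squared modulus of the complex Gram determinant**: for a
complex-linear `L : E → V`, a real orthonormal basis `b` of `E` and a complex orthonormal basis
`e` of `E`, `det (⟪L bᵢ, L bⱼ⟫_ℝ)ᵢⱼ = |det (⟪L eₖ, L eₗ⟫_ℂ)ₖₗ|²` — the determinant of the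
realification of a complex-linear endomorphism is the norm `N_{ℂ/ℝ}` of its complex determinant.
[Chirka1989, §14.1, proof of Lemma 1] [folklore] -/
theorem det_gram_real_eq_normSq_det_gram_complex (L : E →ₗ[ℂ] V) (e : OrthonormalBasis κ ℂ E) :
    letI : InnerProductSpace ℝ E := InnerProductSpace.complexToReal
    letI : InnerProductSpace ℝ V := InnerProductSpace.complexToReal
    ∀ b : OrthonormalBasis ι ℝ E,
      (Matrix.gram ℝ (L ∘ b)).det = Complex.normSq (Matrix.gram ℂ (L ∘ e)).det := by
  letI : InnerProductSpace ℝ E := InnerProductSpace.complexToReal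
  letI : InnerProductSpace ℝ V := InnerProductSpace.complexToReal
  intro b
  rw [det_gram_real_eq_det_restrictScalars L b, det_gram_complex_eq_det,
    LinearMap.det_restrictScalars, Algebra.norm_complex_apply]

omit [FiniteDimensional ℂ E] [FiniteDimensional ℂ V] in
/-- The complex Gram determinant is `≥ 0` (for the order of `ℂ`): complex Gram matrices are
positive semidefinite. [folklore] -/
theorem det_gram_complex_nonneg (L : E →ₗ[ℂ] V) (e : OrthonormalBasis κ ℂ E) :
    0 ≤ (Matrix.gram ℂ (L ∘ e)).det :=
  (Matrix.posSemidef_gram ℂ (L ∘ e)).det_nonneg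

omit [FiniteDimensional ℂ E] [FiniteDimensional ℂ V] in
/-- The complex Gram determinant is real. [folklore] -/
theorem im_det_gram_complex_eq_zero (L : E →ₗ[ℂ] V) (e : OrthonormalBasis κ ℂ E) :
    ((Matrix.gram ℂ (L ∘ e)).det).im = 0 :=
  ((Complex.nonneg_iff.1 (det_gram_complex_nonneg L e)).2).symm

omit [FiniteDimensional ℂ E] [FiniteDimensional ℂ V] in
/-- The complex Gram determinant has nonnegative real part. [folklore] -/
theorem re_det_gram_complex_nonneg (L : E →ₗ[ℂ] V) (e : OrthonormalBasis κ ℂ E) :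
    0 ≤ ((Matrix.gram ℂ (L ∘ e)).det).re :=
  (Complex.nonneg_iff.1 (det_gram_complex_nonneg L e)).1

omit [FiniteDimensional ℂ E] [FiniteDimensional ℂ V] in
/-- The complex Gram determinant, as the coercion of its (nonnegative) real part. [folklore] -/
theorem det_gram_complex_eq_coe_re (L : E →ₗ[ℂ] V) (e : OrthonormalBasis κ ℂ E) :
    (Matrix.gram ℂ (L ∘ e)).det = (((Matrix.gram ℂ (L ∘ e)).det).re : ℂ) :=
  Complex.ext (by simp) (by simp [im_det_gram_complex_eq_zero])

/-- `det (⟪L bᵢ, L bⱼ⟫_ℝ) = (Re det (⟪L eₖ, L eₗ⟫_ℂ))²`. [folklore] -/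
theorem det_gram_real_eq_sq_re_det_gram_complex (L : E →ₗ[ℂ] V) (e : OrthonormalBasis κ ℂ E) :
    letI : InnerProductSpace ℝ E := InnerProductSpace.complexToReal
    letI : InnerProductSpace ℝ V := InnerProductSpace.complexToReal
    ∀ b : OrthonormalBasis ι ℝ E,
      (Matrix.gram ℝ (L ∘ b)).det = ((Matrix.gram ℂ (L ∘ e)).det).re ^ 2 := by
  letI : InnerProductSpace ℝ E := InnerProductSpace.complexToReal
  letI : InnerProductSpace ℝ V := InnerProductSpace.complexToReal
  intro b
  rw [det_gram_real_eq_normSq_det_gram_complex L e b, Complex.normSq_apply,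
    im_det_gram_complex_eq_zero, mul_zero, add_zero, sq]

/-- **Wirtinger's equality for the Jacobian of a complex-linear map**: the `2p`-dimensional real
Jacobian `J_{2p}(L) = √(det (⟪L bᵢ, L bⱼ⟫_ℝ)ᵢⱼ)` of a complex-linear map `L : E → V`
(`dim_ℂ E = p`, `b` any real orthonormal basis of `E`) equals the complex Gram determinant
`det (⟪L eₖ, L eₗ⟫_ℂ)ₖₗ` of any complex orthonormal basis `e` of `E` (a nonnegative real number).
In coordinates this is `J_{2p}(L) = det (MᴴM) = Σ_{#I=p} |det M_I|²` for the matrix `M` of `L`,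
the pointwise content of Wirtinger's theorem `vol_{2p}(A) = ∫_A ωᵖ/p!` for complex
`p`-dimensional submanifolds. [Chirka1989, §14.1 Lemma 1] [cite: Chirka1989, §14.1 Lemma 1] -/
theorem sqrt_det_gram_real_eq_re_det_gram_complex (L : E →ₗ[ℂ] V) (e : OrthonormalBasis κ ℂ E) :
    letI : InnerProductSpace ℝ E := InnerProductSpace.complexToReal
    letI : InnerProductSpace ℝ V := InnerProductSpace.complexToReal
    ∀ b : OrthonormalBasis ι ℝ E,
      Real.sqrt (Matrix.gram ℝ (L ∘ b)).det = ((Matrix.gram ℂ (L ∘ e)).det).re := by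
  letI : InnerProductSpace ℝ E := InnerProductSpace.complexToReal
  letI : InnerProductSpace ℝ V := InnerProductSpace.complexToReal
  intro b
  rw [det_gram_real_eq_sq_re_det_gram_complex L e b, Real.sqrt_sq (re_det_gram_complex_nonneg L e)]

omit [FiniteDimensional ℂ E] [FiniteDimensional ℂ V] in
/-- The complex Gram matrix of an isometric complex-linear map in an orthonormal basis is the
identity. [folklore] -/
theorem gram_complex_eq_one_of_inner_map_map (L : E →ₗ[ℂ] V)
    (hL : ∀ x y : E, ⟪L x, L y⟫_ℂ = ⟪x, y⟫_ℂ) (e : OrthonormalBasis κ ℂ E) :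
    Matrix.gram ℂ (L ∘ e) = 1 := by
  ext k l
  rw [Matrix.gram_apply, Function.comp_apply, Function.comp_apply, hL, Matrix.one_apply]
  exact (orthonormal_iff_ite.1 e.orthonormal) k l

/-- **A complex-linear isometry has Jacobian `1`**: if `⟪L x, L y⟫ = ⟪x, y⟫` then
`√(det (⟪L bᵢ, L bⱼ⟫_ℝ)) = 1` for every real orthonormal basis `b` of `E` (a unitary `p`-frame
spans a real `2p`-plane of unit `2p`-volume). [folklore] -/
theorem sqrt_det_gram_real_eq_one_of_inner_map_map (L : E →ₗ[ℂ] V)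
    (hL : ∀ x y : E, ⟪L x, L y⟫_ℂ = ⟪x, y⟫_ℂ) :
    letI : InnerProductSpace ℝ E := InnerProductSpace.complexToReal
    letI : InnerProductSpace ℝ V := InnerProductSpace.complexToReal
    ∀ b : OrthonormalBasis ι ℝ E, Real.sqrt (Matrix.gram ℝ (L ∘ b)).det = 1 := by
  letI : InnerProductSpace ℝ E := InnerProductSpace.complexToReal
  letI : InnerProductSpace ℝ V := InnerProductSpace.complexToReal
  intro b
  rw [sqrt_det_gram_real_eq_re_det_gram_complex L (stdOrthonormalBasis ℂ E) b,
    gram_complex_eq_one_of_inner_map_map L hL, Matrix.det_one, Complex.one_re]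

end ComplexGram

end Literature.Geometry.Kaehler

end
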